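import Summits.QuantumFields.YangMills.Theorems.ConvexGribovBodyBrascampLiebVacuumSCGapAssemblyHelpers

/-!
# Crux `BrascampLiebVacuumSC` (stmt-QuantumFields-16404), line `SketchIdeator1`, skeleton v7:
# the stub `stub_gapAssembly` (metric-entropy assembly of the Haar dimension gap)

Registered stub of skeleton v7 (`Cruxes/BrascampLiebVacuumSC/Lines/SketchIdeator1.lean`, lead c4),
proved verbatim. For a compact simple `G` (connected, non-abelian) with a faithful unitary `ρ`, write
`B_ε = {g : ‖ρ g − 1‖²_F < ε²}`, `J_ε = {g : ∃ j, j² = 1, ‖ρ g − ρ j‖²_F < ε²}` and `μ` for the Haar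
probability measure. ASSUMING a subspace `V = 𝔥` of the matrix space charting a neighbourhood of `1`
through `exp` (hypotheses `hVcar`, `hchart`), the eigenspace bound `3·dim span(𝔥 ∩ 𝔭_j) < 2·dim 𝔥` for
non-central involutions (`hdim`), Euclidean `ε`-nets/packings of `W ∩ B_s` of size `≍ ε^{−dim W}` for every
subspace `W` (`heuclid`), the Haar sandwich (`hsandwich`) and local bi-Lipschitz/rigidity of `exp` (`hexp`),
we get `d < 3m`, `c ε^d ≤ μ(B_ε)` and `μ(J_ε) ≤ C ε^m` for `0 < ε ≤ ε₀`, with `d = dim V` and `m = d − p`,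
`p = max_i dim span(V ∩ 𝔭_{j_i})` over a finite `η`-net `(j_i)` of the involutions:

1. `d > 0` (`GapAssembly.finrank_pos`) and `3p < 2d` (`hdim` for non-central `j_i`, `p_i = 0` for central
   ones by `GapAssembly.eq_zero_of_mem_center`), so `d < 3(d − p)`;
2. ball growth from the `ε`-net `SG · ρ⁻¹(exp T)` of `G` (`GapAssembly.exists_net`) and the sandwich;
3. the upper ball bound `μ(B_ε) ≤ C_V (4ε)^d` from the packing `ρ⁻¹(exp T)` (`GapAssembly.exists_packing`);
4. thin involutions (`GapAssembly.thin_cover`, this file): `J_ε ⊆ ⋃_i ⋃_{Y ∈ T_i} (i·ρ⁻¹(exp Y))·B_{4ε}`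
   with `|T_i| ≤ C_i ε^{−p_i}`, so `μ(J_ε) ≤ (Σ_i C_i) C_V 16^d ε^{d−p}` for `ε ≤ min 1 (s/16)`.

Helpers: `Theorems/ConvexGribovBodyBrascampLiebVacuumSCGapAssemblyHelpers.lean`. No named facts are used.
-/

set_option autoImplicit false

open scoped BigOperators Topology Matrix ENNReal
open Filter MeasureTheory
open Literature.MathematicalPhysics.QuantumFieldTheory
open Summit.QuantumFields.YangMills.Cruxes.CovarianceBound.SupportWindow (froSq)

noncomputable section

namespace Summit.QuantumFields.YangMills.Theorems.BrascampLiebVacuumSC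

namespace GapAssembly

variable {G : Type} [Group G] [TopologicalSpace G]

/-! ### Thin involutions: the covering -/

/-- **Covering of the `ε`-neighbourhood of the involutions.** With an `η`-net `SJ` of the involutions,
the chart at scale `s`, rigidity of near-involutions and `ε`-nets `T i` of `span(V ∩ 𝔭_i) ∩ B_s`:
every `g` within `ε` of an involution `j` has `ρ j = ρ i · e^X` with `X ∈ V ∩ 𝔭_i ∩ B_s`, hence lies
within `4ε` of a centre `i · ρ⁻¹(exp Y)`, `Y ∈ T i`; by left invariance
`μ(J_ε) ≤ (Σ_i |T i|) · μ(B_{4ε})`. [folklore] -/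
theorem thin_cover [IsTopologicalGroup G] [CompactSpace G] [MeasurableSpace G] [BorelSpace G]
    (r : LatticeRep G) (V : Submodule ℝ (Matrix (Fin r.N) (Fin r.N) ℂ))
    (hV1 : ∀ X ∈ V, NormedSpace.exp X ∈ Set.range r.ρ) {s η r₀ ε : ℝ} (hsr : s ^ 2 ≤ r₀ ^ 2)
    (hch : ∀ g : G, froSq (r.ρ g - 1) < η ^ 2 →
      ∃ X ∈ V, froSq X < s ^ 2 ∧ NormedSpace.exp X = r.ρ g)
    (hlip : ∀ X Y : Matrix (Fin r.N) (Fin r.N) ℂ, froSq X < r₀ ^ 2 → froSq Y < r₀ ^ 2 →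
      froSq (NormedSpace.exp X - NormedSpace.exp Y) ≤ 4 * froSq (X - Y))
    (hrig : ∀ P X : Matrix (Fin r.N) (Fin r.N) ℂ, P * P = 1 →
      P ∈ Matrix.unitaryGroup (Fin r.N) ℂ → froSq X < r₀ ^ 2 →
      P * NormedSpace.exp X * (P * NormedSpace.exp X) = 1 → P * X * P = -X)
    (SJ : Finset G) (hSJ1 : ∀ i ∈ SJ, i * i = 1)
    (hSJ2 : ∀ j : G, j * j = 1 → ∃ i ∈ SJ, froSq (r.ρ j - r.ρ i) < η ^ 2)
    (T : G → Finset (Matrix (Fin r.N) (Fin r.N) ℂ))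
    (hT1 : ∀ i ∈ SJ, ↑(T i) ⊆
      ((Submodule.span ℝ ((V : Set (Matrix (Fin r.N) (Fin r.N) ℂ)) ∩
        {X | r.ρ i * X * r.ρ i = -X}) : Submodule ℝ (Matrix (Fin r.N) (Fin r.N) ℂ)) :
          Set (Matrix (Fin r.N) (Fin r.N) ℂ)) ∩ {X | froSq X < s ^ 2})
    (hT2 : ∀ i ∈ SJ, ∀ X ∈ Submodule.span ℝ ((V : Set (Matrix (Fin r.N) (Fin r.N) ℂ)) ∩
        {X | r.ρ i * X * r.ρ i = -X}), froSq X < s ^ 2 → ∃ Y ∈ T i, froSq (X - Y) < ε ^ 2) :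
    haarProbability G {g : G | ∃ j : G, j * j = 1 ∧ froSq (r.ρ g - r.ρ j) < ε ^ 2} ≤
      (∑ i ∈ SJ, ((T i).card : ℝ≥0∞)) *
        haarProbability G {g : G | froSq (r.ρ g - 1) < (4 * ε) ^ 2} := by
  classical
  have hcov : {g : G | ∃ j : G, j * j = 1 ∧ froSq (r.ρ g - r.ρ j) < ε ^ 2} ⊆
      ⋃ i ∈ SJ, ⋃ Y ∈ T i,
        {g : G | froSq (r.ρ g - r.ρ (i * Function.invFun r.ρ (NormedSpace.exp Y))) < (4 * ε) ^ 2} := by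
    rintro g ⟨j, hj, hgj⟩
    obtain ⟨i, hi, hji⟩ := hSJ2 j hj
    have hii : i * i = 1 := hSJ1 i hi
    rw [← HaarSandwich.froSq_inv_mul_sub_one] at hji
    obtain ⟨X, hXV, hXs, hXe⟩ := hch (i⁻¹ * j) hji
    rw [inv_eq_of_mul_eq_one_right hii, map_mul] at hXe
    have hP : r.ρ i * r.ρ i = 1 := by rw [← map_mul, hii, map_one]
    have hPe : r.ρ i * NormedSpace.exp X = r.ρ j := by rw [hXe, ← mul_assoc, hP, one_mul]
    have hK : r.ρ i * X * r.ρ i = -X :=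
      hrig _ _ hP (r.mem_unitary i) (hXs.trans_le hsr) (by rw [hPe, ← map_mul, hj, map_one])
    have hXW : X ∈ Submodule.span ℝ ((V : Set (Matrix (Fin r.N) (Fin r.N) ℂ)) ∩
        {X | r.ρ i * X * r.ρ i = -X}) := Submodule.subset_span ⟨hXV, hK⟩
    obtain ⟨Y, hY, hXY⟩ := hT2 i hi X hXW hXs
    have hY' := hT1 i hi (Finset.mem_coe.2 hY)
    have hYV : Y ∈ V := by
      have hle : Submodule.span ℝ ((V : Set (Matrix (Fin r.N) (Fin r.N) ℂ)) ∩
          {X | r.ρ i * X * r.ρ i = -X}) ≤ V := Submodule.span_le.2 Set.inter_subset_left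
      exact hle hY'.1
    simp only [Set.mem_iUnion, Set.mem_setOf_eq, exists_prop]
    refine ⟨i, hi, Y, hY, ?_⟩
    have hρc : r.ρ (i * Function.invFun r.ρ (NormedSpace.exp Y)) = r.ρ i * NormedSpace.exp Y := by
      rw [map_mul, rho_invFun r (hV1 Y hYV)]
    have h1 : froSq (r.ρ j - r.ρ (i * Function.invFun r.ρ (NormedSpace.exp Y))) < 4 * ε ^ 2 := by
      rw [hρc, ← hPe, froSq_rho_mul_sub]
      calc froSq (NormedSpace.exp X - NormedSpace.exp Y) ≤ 4 * froSq (X - Y) :=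
            hlip X Y (hXs.trans_le hsr) (hY'.2.trans_le hsr)
        _ < 4 * ε ^ 2 := by gcongr
    have hadd := GaugeAlgebra.froSq_add_le (r.ρ g - r.ρ j)
      (r.ρ j - r.ρ (i * Function.invFun r.ρ (NormedSpace.exp Y)))
    rw [sub_add_sub_cancel] at hadd
    have h16 : (4 * ε) ^ 2 = 16 * ε ^ 2 := by ring
    rw [h16]
    linarith [sq_nonneg ε]
  calc haarProbability G {g : G | ∃ j : G, j * j = 1 ∧ froSq (r.ρ g - r.ρ j) < ε ^ 2}
      ≤ haarProbability G (⋃ i ∈ SJ, ⋃ Y ∈ T i,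
          {g : G | froSq (r.ρ g - r.ρ (i * Function.invFun r.ρ (NormedSpace.exp Y))) < (4 * ε) ^ 2}) :=
        measure_mono hcov
    _ ≤ ∑ i ∈ SJ, haarProbability G (⋃ Y ∈ T i,
          {g : G | froSq (r.ρ g - r.ρ (i * Function.invFun r.ρ (NormedSpace.exp Y))) < (4 * ε) ^ 2}) :=
        measure_biUnion_finset_le SJ _
    _ ≤ ∑ i ∈ SJ, ∑ Y ∈ T i, haarProbability G
          {g : G | froSq (r.ρ g - r.ρ (i * Function.invFun r.ρ (NormedSpace.exp Y))) < (4 * ε) ^ 2} :=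
        Finset.sum_le_sum fun i _ => measure_biUnion_finset_le _ _
    _ = ∑ i ∈ SJ, ∑ _Y ∈ T i, haarProbability G {g : G | froSq (r.ρ g - 1) < (4 * ε) ^ 2} := by
        refine Finset.sum_congr rfl fun i _ => Finset.sum_congr rfl fun Y _ => ?_
        exact HaarSandwich.measure_froBall_eq r _ _
    _ = (∑ i ∈ SJ, ((T i).card : ℝ≥0∞)) *
          haarProbability G {g : G | froSq (r.ρ g - 1) < (4 * ε) ^ 2} := by
        rw [Finset.sum_mul]
        refine Finset.sum_congr rfl fun i _ => ?_
        rw [Finset.sum_const, nsmul_eq_mul]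

end GapAssembly

open GapAssembly

/-- **Stub `stub_gapAssembly` (the metric-entropy assembly).** For a compact simple `G` (connected,
non-abelian) with faithful unitary `ρ`: IF `V = 𝔥` is a subspace charting a neighbourhood of `1` through
`exp` (F1), non-central involutions have `3·dim(𝔥 ∩ 𝔭_j) < 2·dim 𝔥` (F2), and the three tools (Euclidean
nets in subspaces, the Haar sandwich, local bi-Lipschitz/rigidity of `exp`) hold, THEN the Haar dimension
gap holds with `d = dim 𝔥` and `m = d − p`, `p` the largest `dim span(𝔥 ∩ 𝔭_{j_i})` over a finite `η`-net
`(j_i)` of the involutions. Ball growth: `G = ⋃_{x ∈ SG} x·exp(V ∩ B_s)`, each piece covered by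
`≲ ε^{−d}` Frobenius `ε`-balls (`GapAssembly.exists_net`), so `μ(B_ε) ≥ c ε^d` by the sandwich; a packing
of `exp(V ∩ B_s)` (`GapAssembly.exists_packing`) gives `μ(B_ε) ≤ C ε^d`. Thin involutions
(`GapAssembly.thin_cover`): `μ(J_ε) ≤ Σ_i |T_i| μ(B_{4ε}) ≲ ε^{−p} ε^{d}`. Exponents: `p_i = 0` for central
`j_i` (`GapAssembly.eq_zero_of_mem_center`), `3 p_i < 2d` otherwise (F2), and `d > 0`
(`GapAssembly.finrank_pos`); hence `d < 3(d − p)`. [folklore] -/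
theorem stub_gapAssembly :
    ∀ (G : Type) [Group G] [TopologicalSpace G] [IsTopologicalGroup G] [CompactSpace G]
    [MeasurableSpace G] [BorelSpace G], IsCompactSimpleLieGroup G → ∀ (r : LatticeRep G)
    (V : Submodule ℝ (Matrix (Fin r.N) (Fin r.N) ℂ)),
    ((V : Set (Matrix (Fin r.N) (Fin r.N) ℂ)) =
      {X | ∀ t : ℝ, NormedSpace.exp (t • X) ∈ Set.range r.ρ}) →
    (∀ s : ℝ, 0 < s → ∃ η : ℝ, 0 < η ∧ ∀ g : G, froSq (r.ρ g - 1) < η ^ 2 →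
      ∃ X ∈ V, froSq X < s ^ 2 ∧ NormedSpace.exp X = r.ρ g) →
    (∀ j : G, j * j = 1 → j ∉ Subgroup.center G →
      3 * Module.finrank ℝ ↥(Submodule.span ℝ
            ({X : Matrix (Fin r.N) (Fin r.N) ℂ | ∀ t : ℝ, NormedSpace.exp (t • X) ∈ Set.range r.ρ} ∩
              {X | r.ρ j * X * r.ρ j = -X})) <
        2 * Module.finrank ℝ ↥(Submodule.span ℝ
            {X : Matrix (Fin r.N) (Fin r.N) ℂ | ∀ t : ℝ, NormedSpace.exp (t • X) ∈ Set.range r.ρ})) →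
    (∀ (W : Submodule ℝ (Matrix (Fin r.N) (Fin r.N) ℂ)) (s : ℝ), 0 < s →
      ∃ Ccov : ℝ, 0 < Ccov ∧ ∀ ε : ℝ, 0 < ε → ε ≤ s →
        ∃ T : Finset (Matrix (Fin r.N) (Fin r.N) ℂ),
          (↑T ⊆ (W : Set (Matrix (Fin r.N) (Fin r.N) ℂ)) ∩ {X | froSq X < s ^ 2}) ∧
          (T.card : ℝ) ≤ Ccov / ε ^ Module.finrank ℝ W ∧
          1 ≤ Ccov * ε ^ Module.finrank ℝ W * (T.card : ℝ) ∧
          (∀ X ∈ W, froSq X < s ^ 2 → ∃ Y ∈ T, froSq (X - Y) < ε ^ 2) ∧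
          (∀ X ∈ T, ∀ Y ∈ T, X ≠ Y → ε ^ 2 ≤ froSq (X - Y))) →
    (∀ (ε : ℝ) (T : Finset G), 0 < ε →
      ((∀ g : G, ∃ x ∈ T, froSq (r.ρ g - r.ρ x) < ε ^ 2) →
        1 ≤ (T.card : ℝ) * (haarProbability G {g : G | froSq (r.ρ g - 1) < ε ^ 2}).toReal) ∧
      ((∀ x ∈ T, ∀ y ∈ T, x ≠ y → (2 * ε) ^ 2 ≤ froSq (r.ρ x - r.ρ y)) →
        (T.card : ℝ) * (haarProbability G {g : G | froSq (r.ρ g - 1) < ε ^ 2}).toReal ≤ 1)) →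
    (∃ r₀ : ℝ, 0 < r₀ ∧
      (∀ X Y : Matrix (Fin r.N) (Fin r.N) ℂ, froSq X < r₀ ^ 2 → froSq Y < r₀ ^ 2 →
        froSq (X - Y) ≤ 4 * froSq (NormedSpace.exp X - NormedSpace.exp Y) ∧
        froSq (NormedSpace.exp X - NormedSpace.exp Y) ≤ 4 * froSq (X - Y)) ∧
      (∀ P X : Matrix (Fin r.N) (Fin r.N) ℂ, P * P = 1 → P ∈ Matrix.unitaryGroup (Fin r.N) ℂ →
        froSq X < r₀ ^ 2 → P * NormedSpace.exp X * (P * NormedSpace.exp X) = 1 →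
        P * X * P = -X)) →
    ∃ (d m : ℕ) (c C ε₀ : ℝ), d < 3 * m ∧ 0 < c ∧ 0 < ε₀ ∧
      (∀ ε : ℝ, 0 < ε → ε ≤ ε₀ →
        c * ε ^ d ≤ (haarProbability G {g : G | froSq (r.ρ g - 1) < ε ^ 2}).toReal) ∧
      (∀ ε : ℝ, 0 < ε → ε ≤ ε₀ →
        (haarProbability G {g : G | ∃ j : G, j * j = 1 ∧ froSq (r.ρ g - r.ρ j) < ε ^ 2}).toReal
          ≤ C * ε ^ m) := by
  intro G _ _ _ _ _ _ hG r V hVcar hchart hdim heuclid hsandwich hexp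
  classical
  -- Step 0: unpacking
  have hV : ∀ X ∈ V, ∀ t : ℝ, NormedSpace.exp (t • X) ∈ Set.range r.ρ := by
    intro X hX
    have hX' : X ∈ (V : Set (Matrix (Fin r.N) (Fin r.N) ℂ)) := hX
    rw [hVcar] at hX'
    exact hX'
  have hV1 : ∀ X ∈ V, NormedSpace.exp X ∈ Set.range r.ρ := fun X hX => by
    simpa using hV X hX 1
  obtain ⟨r₀, hr₀, hlip, hrig⟩ := hexp
  have hlipL : ∀ X Y : Matrix (Fin r.N) (Fin r.N) ℂ, froSq X < r₀ ^ 2 → froSq Y < r₀ ^ 2 →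
      froSq (X - Y) ≤ 4 * froSq (NormedSpace.exp X - NormedSpace.exp Y) :=
    fun X Y hX hY => (hlip X Y hX hY).1
  have hlipU : ∀ X Y : Matrix (Fin r.N) (Fin r.N) ℂ, froSq X < r₀ ^ 2 → froSq Y < r₀ ^ 2 →
      froSq (NormedSpace.exp X - NormedSpace.exp Y) ≤ 4 * froSq (X - Y) :=
    fun X Y hX hY => (hlip X Y hX hY).2
  obtain ⟨s, hs, hsr⟩ : ∃ s : ℝ, 0 < s ∧ s ^ 2 ≤ r₀ ^ 2 := ⟨r₀, hr₀, le_rfl⟩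
  obtain ⟨η, hη, hch⟩ := hchart s hs
  obtain ⟨CV, hCV, hnetV⟩ := heuclid V s hs
  -- Step 1: `d = dim V > 0`
  obtain ⟨d, hdV⟩ : ∃ d : ℕ, Module.finrank ℝ V = d := ⟨_, rfl⟩
  have hd : 0 < d := hdV ▸ finrank_pos hG r V hchart
  -- Step 2: finite nets of `G` and of the involutions
  obtain ⟨SG, -, hSG'⟩ := exists_finset_net r isCompact_univ hη
  have hSG : ∀ g : G, ∃ x ∈ SG, froSq (r.ρ g - r.ρ x) < η ^ 2 := fun g =>
    hSG' g (Set.mem_univ g)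
  obtain ⟨SJ, hSJ1, hSJ2⟩ := exists_finset_net r (isCompact_invol r) hη
  have hSGpos : (0 : ℝ) < SG.card := by
    obtain ⟨x, hx, -⟩ := hSG 1
    exact_mod_cast Finset.card_pos.2 ⟨x, hx⟩
  -- Step 3: the `−1`-eigenspaces and the exponents
  set W : G → Submodule ℝ (Matrix (Fin r.N) (Fin r.N) ℂ) := fun i =>
    Submodule.span ℝ ((V : Set (Matrix (Fin r.N) (Fin r.N) ℂ)) ∩ {X | r.ρ i * X * r.ρ i = -X})
    with hW
  have hCc : ∀ i : G, ∃ Ccov : ℝ, 0 < Ccov ∧ ∀ ε : ℝ, 0 < ε → ε ≤ s →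
      ∃ T : Finset (Matrix (Fin r.N) (Fin r.N) ℂ),
        (↑T ⊆ (W i : Set (Matrix (Fin r.N) (Fin r.N) ℂ)) ∩ {X | froSq X < s ^ 2}) ∧
        (T.card : ℝ) ≤ Ccov / ε ^ Module.finrank ℝ (W i) ∧
        1 ≤ Ccov * ε ^ Module.finrank ℝ (W i) * (T.card : ℝ) ∧
        (∀ X ∈ W i, froSq X < s ^ 2 → ∃ Y ∈ T, froSq (X - Y) < ε ^ 2) ∧
        (∀ X ∈ T, ∀ Y ∈ T, X ≠ Y → ε ^ 2 ≤ froSq (X - Y)) := fun i => heuclid (W i) s hs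
  choose Cc hCc0 hCcT using hCc
  set p : G → ℕ := fun i => Module.finrank ℝ (W i) with hp
  set pmax : ℕ := SJ.sup p with hpmax
  have hpi : ∀ i ∈ SJ, 3 * p i < 2 * d := by
    intro i hi
    have hii : i * i = 1 := hSJ1 i hi
    by_cases hic : i ∈ Subgroup.center G
    · have hbot : W i = ⊥ := by
        refine Submodule.span_eq_bot.2 fun X hX => ?_
        exact eq_zero_of_mem_center r V hV hr₀ hlipL hii hic hX.1 hX.2
      have hp0 : p i = 0 := by
        show Module.finrank ℝ (W i) = 0
        rw [hbot, finrank_bot]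
      omega
    · have h := hdim i hii hic
      rw [← hVcar, Submodule.span_eq, hdV] at h
      exact h
  have hpmax_le : pmax ≤ (2 * d - 1) / 3 :=
    Finset.sup_le fun i hi => by have := hpi i hi; omega
  have h3 : 3 * pmax < 2 * d := by omega
  have hpd : pmax ≤ d := by omega
  -- Step 4: ball growth (lower bound)
  have hlow : ∀ ε : ℝ, 0 < ε → ε ≤ s →
      1 / (2 ^ d * SG.card * CV) * ε ^ d ≤
        (haarProbability G {g : G | froSq (r.ρ g - 1) < ε ^ 2}).toReal := by
    intro ε hε hεs
    obtain ⟨T, hT1, hTcard, -, hT2, -⟩ := hnetV (ε / 2) (by positivity) (by linarith)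
    rw [hdV] at hTcard
    obtain ⟨Tc, hTc, hnet⟩ := exists_net r V hV1 hsr hch hlipU SG hSG T hT1 hT2
    have h1 := (hsandwich ε Tc hε).1 hnet
    set mB := (haarProbability G {g : G | froSq (r.ρ g - 1) < ε ^ 2}).toReal with hmB
    have hmB0 : 0 ≤ mB := ENNReal.toReal_nonneg
    have hε2 : (0 : ℝ) < (ε / 2) ^ d := by positivity
    have hTc' : (Tc.card : ℝ) ≤ SG.card * (CV / (ε / 2) ^ d) := by
      calc (Tc.card : ℝ) ≤ ((SG.card * T.card : ℕ) : ℝ) := by exact_mod_cast hTc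
        _ = (SG.card : ℝ) * T.card := by push_cast; ring
        _ ≤ SG.card * (CV / (ε / 2) ^ d) := by gcongr
    have h2 : 1 ≤ SG.card * (CV / (ε / 2) ^ d) * mB :=
      h1.trans (mul_le_mul_of_nonneg_right hTc' hmB0)
    have key : (ε / 2) ^ d ≤ SG.card * CV * mB := by
      have h3' := mul_le_mul_of_nonneg_left h2 hε2.le
      rw [mul_one] at h3'
      calc (ε / 2) ^ d ≤ (ε / 2) ^ d * (SG.card * (CV / (ε / 2) ^ d) * mB) := h3'
        _ = SG.card * CV * mB := by field_simp
    calc 1 / (2 ^ d * SG.card * CV) * ε ^ d = (ε / 2) ^ d / (SG.card * CV) := by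
          rw [div_pow]; field_simp
      _ ≤ mB := by
          rw [div_le_iff₀ (by positivity)]
          linarith [key]
  -- Step 5: ball upper bound (packing)
  have hup : ∀ ε : ℝ, 0 < ε → 4 * ε ≤ s →
      (haarProbability G {g : G | froSq (r.ρ g - 1) < ε ^ 2}).toReal ≤ CV * (4 * ε) ^ d := by
    intro ε hε hεs
    obtain ⟨T, hT1, -, hTcard, -, hT3⟩ := hnetV (4 * ε) (by positivity) hεs
    rw [hdV] at hTcard
    obtain ⟨TG, hTG, hsep⟩ := exists_packing r V hV1 hsr hε hlipL T hT1 hT3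
    have h2 := (hsandwich ε TG hε).2 hsep
    rw [hTG] at h2
    set mB := (haarProbability G {g : G | froSq (r.ρ g - 1) < ε ^ 2}).toReal with hmB
    have hTpos : (0 : ℝ) < T.card := by
      by_contra h0
      push Not at h0
      have hT0 : (T.card : ℝ) = 0 := le_antisymm h0 (Nat.cast_nonneg _)
      rw [hT0, mul_zero] at hTcard
      linarith
    have hm : mB * T.card ≤ CV * (4 * ε) ^ d * T.card := by linarith
    exact le_of_mul_le_mul_right hm hTpos
  -- Step 6: thin involutions
  have hthin : ∀ ε : ℝ, 0 < ε → ε ≤ 1 → 16 * ε ≤ s →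
      (haarProbability G {g : G | ∃ j : G, j * j = 1 ∧ froSq (r.ρ g - r.ρ j) < ε ^ 2}).toReal ≤
        (∑ i ∈ SJ, Cc i) * CV * 16 ^ d * ε ^ (d - pmax) := by
    intro ε hε hε1 hεs
    have hεs' : ε ≤ s := by linarith
    have hT : ∀ i : G, ∃ T : Finset (Matrix (Fin r.N) (Fin r.N) ℂ),
        (↑T ⊆ (W i : Set (Matrix (Fin r.N) (Fin r.N) ℂ)) ∩ {X | froSq X < s ^ 2}) ∧
        (T.card : ℝ) ≤ Cc i / ε ^ Module.finrank ℝ (W i) ∧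
        1 ≤ Cc i * ε ^ Module.finrank ℝ (W i) * (T.card : ℝ) ∧
        (∀ X ∈ W i, froSq X < s ^ 2 → ∃ Y ∈ T, froSq (X - Y) < ε ^ 2) ∧
        (∀ X ∈ T, ∀ Y ∈ T, X ≠ Y → ε ^ 2 ≤ froSq (X - Y)) := fun i => hCcT i ε hε hεs'
    choose T hT1 hT2 _hT3 hT4 _hT5 using hT
    have hcov := thin_cover r V hV1 hsr hch hlipU hrig SJ hSJ1 hSJ2 T (fun i _ => hT1 i)
      (fun i _ => hT4 i)
    have hB := hup (4 * ε) (by positivity) (by linarith)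
    set mB := (haarProbability G {g : G | froSq (r.ρ g - 1) < (4 * ε) ^ 2}).toReal with hmB
    set mJ := (haarProbability G
      {g : G | ∃ j : G, j * j = 1 ∧ froSq (r.ρ g - r.ρ j) < ε ^ 2}).toReal with hmJ
    have hfin : (∑ i ∈ SJ, ((T i).card : ℝ≥0∞)) *
        haarProbability G {g : G | froSq (r.ρ g - 1) < (4 * ε) ^ 2} ≠ ∞ :=
      ENNReal.mul_ne_top (ENNReal.sum_ne_top.2 fun i _ => ENNReal.natCast_ne_top _)
        (measure_ne_top _ _)
    have h1 : mJ ≤ (∑ i ∈ SJ, ((T i).card : ℝ)) * mB := by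
      have := ENNReal.toReal_mono hfin hcov
      rw [ENNReal.toReal_mul, ENNReal.toReal_sum (fun i _ => ENNReal.natCast_ne_top _)] at this
      simpa only [ENNReal.toReal_natCast] using this
    have hCsum : 0 ≤ ∑ i ∈ SJ, Cc i := Finset.sum_nonneg fun i _ => (hCc0 i).le
    have h2 : ∑ i ∈ SJ, ((T i).card : ℝ) ≤ (∑ i ∈ SJ, Cc i) / ε ^ pmax := by
      rw [Finset.sum_div]
      refine Finset.sum_le_sum fun i hi => (hT2 i).trans ?_
      refine div_le_div_of_nonneg_left (hCc0 i).le (by positivity) ?_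
      exact pow_le_pow_of_le_one hε.le hε1 (Finset.le_sup (f := p) hi)
    have hmB0 : 0 ≤ mB := ENNReal.toReal_nonneg
    calc mJ ≤ (∑ i ∈ SJ, ((T i).card : ℝ)) * mB := h1
      _ ≤ (∑ i ∈ SJ, Cc i) / ε ^ pmax * (CV * (4 * (4 * ε)) ^ d) :=
          mul_le_mul h2 hB hmB0 (div_nonneg hCsum (by positivity))
      _ = (∑ i ∈ SJ, Cc i) * CV * 16 ^ d * ε ^ (d - pmax) := by
          have hεd : ε ^ d = ε ^ (d - pmax) * ε ^ pmax := by
            rw [← pow_add, Nat.sub_add_cancel hpd]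
          rw [show (4 * (4 * ε)) = 16 * ε by ring, mul_pow, hεd]
          field_simp
  -- Step 7: conclusion
  refine ⟨d, d - pmax, 1 / (2 ^ d * SG.card * CV), (∑ i ∈ SJ, Cc i) * CV * 16 ^ d,
    min 1 (s / 16), by omega, by positivity, by positivity, fun ε hε hε₀ => hlow ε hε ?_,
    fun ε hε hε₀ => ?_⟩
  · have := le_trans hε₀ (min_le_right _ _)
    linarith
  · have hε1 : ε ≤ 1 := le_trans hε₀ (min_le_left _ _)
    have hε16 : 16 * ε ≤ s := by
      have := le_trans hε₀ (min_le_right _ _)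
      linarith
    exact hthin ε hε hε1 hε16

end Summit.QuantumFields.YangMills.Theorems.BrascampLiebVacuumSC

end
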